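import Summits.QuantumFields.BalabanUV.T4Continuum.Support.CTAdmissibleRate

/-!
# T⁴ programme, SUBSTRATE (shared lattice-gauge analysis library) — THE NON-VACUITY OF VEC-6: Bałaban's vector propagator `𝒢(a) = Δ_a⁻¹`
# ([B5] (1.69)) decays at SOME level-free rate `κ > 0` with a level-free constant `C > 0` — both chosen BEFORE the lattice — on every torus
# `T_η`, with NO displayed hypothesis beyond `0 < a`, `0 < a′`, `2 ≤ n·M_μ` (programme VEC, closing item VEC-7 = typer W-18′, ruling (λ18′) journal l.18575; LIBRARY L-A4b)

Substrate cell `b2b-balaban-substrate-*`, seat p3 (gen 3).  `CTVectorPropagator` (VEC-6, p221261) proves the `ℓ²` set ∕ pairing ∕ entry decay of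
`𝒢(a)` «for every `κ ≥ 0` meeting `Jfree d a′ κ 1 < γ′`, `CTGaugeTerm.deltaK d a′ κ 1 < σ₀²`, `JA d a a′ κ 1 < gammaA d a`»; NE2 leaf-06-g4's
`CTAdmissibleRate` (p229563; CLAIM RULE 1 holder of that module — journal l.17864 ∕ l.18391, substrate-p3's crossed W-18 YIELDED l.18527) proves
that these windows hold for ALL `κ` near `0` in the COMPOSABLE form `eventually_Jfree_lt ∕ eventually_deltaK_lt ∕ eventually_JA_lt (any γ > 0)` +
`exists_pos_le_one_of_eventually`.  This follower composes the two BY NAME and nothing else: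
 * `exists_admissible_rate_vec` — `∃ κ ∈ (0, 1]` meeting VEC-6's three conditions at `(d, a, a′, Λ)` (right-hand side `gammaA d a`);
 * **`calG_setDecay_levelFree`**, **`calG_entry_decay_levelFree`** — VEC-6's set ∕ entry decay statements with the `κ`-window DISCHARGED: `∃ κ C, 0 < κ ∧ 0 < C ∧ ∀ n M …` (the quantifiers over the lattice come AFTER `κ, C`: both depend on `(d, a, a′)` only;
   `C = (gammaA d a − JA d a a′ κ 1)⁻¹`).
HONEST FRAMING (T4-DAG p. 1).  A composition of landed lemmas ([folklore]); EXISTENCE ONLY — no admissible `κ` is computed (the closed-form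
windows are astronomically small: R-ne9leaf10g13-1's `σ₀⁻⁴` sizing, leaf-06-g4's indicative `κ ≈ 10⁻⁵⁵` at `d = 4`; a sharper `σ₀` = R3-1 stays ON
REQUEST); `U = 1`, MODEL level, finite tori; NOT an estimate of any NE row; NE2 NOT proved; spine 0/9 unchanged; NOT infinite volume ∕ mass gap ∕
Clay.  HOMONYM GUARD: `deltaK` here is `CTGaugeTerm.deltaK d a′ κ Λ`, fully qualified.  HONEST DEPENDENCY: continuum YM on T⁴ ⇐ BetaPertH ∧ nine
spine estimates (0/9 proved); BetaPertH ⇐ (D1) ∧ (D4) ∧ CAP+tail; G-an2-4 gates asym, D1 and NE2/3/4.  ABSOLUTE RULE kept; no `sorry`.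
-/

noncomputable section

open scoped BigOperators ComplexConjugate Matrix Matrix.Norms.L2Operator Topology
open Filter

namespace Summit.QuantumFields.BalabanUV.T4Continuum.CTVectorPropagatorLevelFree

open Literature.MathematicalPhysics.QuantumFieldTheory.Balaban1983to89.B5Prop11Plancherel (Tor fine calG)
open Literature.MathematicalPhysics.QuantumFieldTheory.Balaban1983to89.B5Prop11Lower (nsq)
open Literature.MathematicalPhysics.QuantumFieldTheory.Balaban1983to89.Beta.DeltaACombesThomas (gammaA gammaA_pos)
open Literature.MathematicalPhysics.QuantumFieldTheory.Balaban1983to89.Beta.TorusG0Decay (ldist)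
open Summit.QuantumFields.BalabanUV.T4Continuum
open Summit.QuantumFields.BalabanUV.T4Continuum.ScalarAveragedPropagator (gammaPs)
open Summit.QuantumFields.BalabanUV.T4Continuum.ScalarAveragedCompression (sigma0)
open Summit.QuantumFields.BalabanUV.T4Continuum.CTScalarGreen (Jfree)
open Summit.QuantumFields.BalabanUV.T4Continuum.CTVectorPropagator (JA calG_setDecay' calG_entry_decay')
open Summit.QuantumFields.BalabanUV.T4Continuum.CTAdmissibleRate (eventually_Jfree_lt eventually_deltaK_lt eventually_JA_lt
  exists_pos_le_one_of_eventually)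

variable (d : ℕ) (a : ℝ) {a' : ℝ}

/-- **AN ADMISSIBLE RATE FOR VEC-6 EXISTS**: `∃ κ ∈ (0, 1]` with `Jfree d a′ κ Λ < γ′`, `CTGaugeTerm.deltaK d a′ κ Λ < σ₀²`, `JA d a a′ κ Λ < gammaA d a`
(leaf-06-g4's three windows at `𝓝 0`, intersected, right-hand side `gammaA d a`). [folklore] -/
theorem exists_admissible_rate_vec (ha' : 0 < a') (Λ : ℝ) :
    ∃ κ : ℝ, 0 < κ ∧ κ ≤ 1 ∧ Jfree d a' κ Λ < gammaPs d a' ∧ CTGaugeTerm.deltaK d a' κ Λ < sigma0 d a' ^ 2 ∧ JA d a a' κ Λ < gammaA d a :=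
  exists_pos_le_one_of_eventually
    ((eventually_Jfree_lt d a' Λ).and ((eventually_deltaK_lt d ha' Λ).and (eventually_JA_lt d a ha' Λ (gammaA_pos (d := d) (a := a)))))

/-- **SET DECAY OF `𝒢(a)` AT A LEVEL-FREE RATE** (VEC-6 `calG_setDecay'` with its window discharged): `∃ κ C > 0` (before the lattice) such that on
every torus with `2 ≤ n·M_μ`, for every non-empty source `T`, every `v` supported over `T` and `u` supported at fine sup-distance `≥ n·r` from `T`,
`|⟨u, 𝒢(a)v⟩| ≤ C·e^{−κr}·‖u‖‖v‖`. [folklore] -/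
theorem calG_setDecay_levelFree (ha : 0 < a) (ha' : 0 < a') :
    ∃ κ C : ℝ, 0 < κ ∧ 0 < C ∧ ∀ (n : ℕ) [NeZero n] (M : Fin d → ℕ) [∀ μ, NeZero (M μ)], (∀ μ, 2 ≤ fine n M μ) →
      ∀ (T : Finset (Tor (fine n M))), T.Nonempty → ∀ {u v : Tor (fine n M) × Fin d → ℂ} {r : ℝ},
        (∀ e, v e ≠ 0 → e.1 ∈ T) → (∀ e, u e ≠ 0 → ∀ t ∈ T, (n : ℝ) * r ≤ ldist (fine n M) e.1 t) →
          ‖star u ⬝ᵥ (calG n (Nat.one_le_iff_ne_zero.mpr (NeZero.ne n)) M a ha *ᵥ v)‖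
            ≤ C * Real.exp (-(κ * r)) * (Real.sqrt (nsq u) * Real.sqrt (nsq v)) := by
  obtain ⟨κ, hκ0, _, hγ, hδ, hJ⟩ := exists_admissible_rate_vec d a ha' 1
  refine ⟨κ, (gammaA d a - JA d a a' κ 1)⁻¹, hκ0, inv_pos.mpr (sub_pos.mpr hJ), ?_⟩
  intro n _ M _ h2 T hT u v r hv hu
  have h := calG_setDecay' n M ha ha' h2 T hT hκ0.le hγ hδ hJ hv hu
  rw [div_eq_mul_inv, mul_comm (Real.exp _)] at h
  exact h

/-- **ENTRY DECAY OF `𝒢(a)` AT A LEVEL-FREE RATE** — THE NON-VACUITY OF VEC-6: `∃ κ C > 0`, depending on `(d, a, a′)` only, with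
`‖𝒢(a)((x, μ), (x′, ν))‖ ≤ C·e^{−κ·dist_∞(x, x′)∕n}` on every torus `T_η` (`η = 1∕n`, `2 ≤ n·M_μ`). [folklore] -/
theorem calG_entry_decay_levelFree (ha : 0 < a) (ha' : 0 < a') :
    ∃ κ C : ℝ, 0 < κ ∧ 0 < C ∧ ∀ (n : ℕ) [NeZero n] (M : Fin d → ℕ) [∀ μ, NeZero (M μ)], (∀ μ, 2 ≤ fine n M μ) →
      ∀ e e' : Tor (fine n M) × Fin d,
        ‖calG n (Nat.one_le_iff_ne_zero.mpr (NeZero.ne n)) M a ha e e'‖ ≤ C * Real.exp (-(κ * (ldist (fine n M) e.1 e'.1 / n))) := by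
  obtain ⟨κ, hκ0, _, hγ, hδ, hJ⟩ := exists_admissible_rate_vec d a ha' 1
  refine ⟨κ, (gammaA d a - JA d a a' κ 1)⁻¹, hκ0, inv_pos.mpr (sub_pos.mpr hJ), ?_⟩
  intro n _ M _ h2 e e'
  rw [mul_comm, ← div_eq_mul_inv]
  exact calG_entry_decay' n M ha ha' h2 hκ0.le hγ hδ hJ e e'

end Summit.QuantumFields.BalabanUV.T4Continuum.CTVectorPropagatorLevelFree

end
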